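import Mathlib.RingTheory.MvPolynomial.Homogeneous
import Mathlib.Algebra.MvPolynomial.PDeriv
import HarnessLib

/-!
# Guo–Kumar–Saptharishi–Solomon 2019, §3.1: Lemma 24 (the inductive reconstruction identity),
# with its first-order Taylor step, over the graded ring `R = F[z]`

Cell `val-lit`, seat t19 (literature-prover); groundwork for the discharge programme of
`GKSS2019_mainThm` (v2, erratum A34) along the printed proof of [GKSS19, §3]. One bookkeeping
definition (`GKSS2019.VanishesBelow t f`: "`f ∈ ⟨z⟩^t`", all monomials of degree `< t` absent) and
THEOREMS; no named facts; nothing here bears on `VP ≠ VNP`, which is NOT proved.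

Source: Z. Guo, M. Kumar, R. Saptharishi, N. Solomon, *Derandomization from algebraic hardness*,
SIAM J. Comput. 51 (2022) = arXiv:1905.00091 [GuoKumarSaptharishiSolomon2019], §3.1 "Proof of
Lemma 24" (held text `paper:arxiv-1905.00091`, p0012.txt:L30–L74), statement of Lemma 24
p0011.txt:L72–L76.

## What is here (decl ↦ printed step)

* `VanishesBelow t f` ↦ "`= 0 mod ⟨z⟩^t`" (§2 notation, p0009.txt:L12); its ideal calculus
  (`add`, `mul`, `mul_left`, `of_isHomogeneous`, `homogeneousComponent_eq_zero`,
  `constantCoeff_eq_zero`, congruence of polynomial maps `vanishesBelow_aeval_sub_aeval`).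
* `exists_taylor_first_order` ↦ "we now expand the above expression as a univariate in `A` (or in
  other words, perform a Taylor expansion of the polynomial `C'` around the point `(R_0, …, R_n)`)"
  (p0012.txt:L41–L45): `C(R + A·e_m) = C(R) + A · (∂_{x_m} C)(R) + A² · T` over any commutative
  ring.
* **`lemma24`** ↦ Lemma 24 (p0011.txt:L72–L76) in abstract form: for `j ≥ 1`, a homogeneous `A` of
  degree `j`, tuples `g, R` with `g_i ≡ R_i + [i = m]·A (mod ⟨z⟩^{j+1})`, `C'(g) = 0` and
  `Ψ := (∂_{x_m} C')(g)(0) ≠ 0`:  `A = (-1/Ψ) · [C'(R)]_j` — the degree-`j` homogeneous part of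
  `C'(R_0, …, R_m)`; the printed "`(-1/Ψ(a)) · C'(Γ_{j-1,a}) = Δ_n(P_{n+j})(z,a) mod ⟨z⟩^{j+1}`" is
  this with `g_i = Δ_i(P)(z,a)`, `R_i = Δ_i(P_{≤ n+j-1})(z,a)`, `A = Δ_n(P_{n+j})(z,a)` (the
  instantiation, via Obs. 22, is `AC/GKSS19ShiftCalculus.lean`'s bidegree lemmas and is made in
  the reconstruction file). The proof follows the print line by line: congruence, Taylor,
  `A² = 0 mod ⟨z⟩^{j+1}`, `α = (∂_{x_m} C')(R)(0) = Ψ(a)` (p0012.txt:L46–L60), solve for `A`.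

## References
* [GuoKumarSaptharishiSolomon2019] arXiv:1905.00091, Lemma 24 (p0011.txt:L72–76) and §3.1
  (p0012.txt:L30–74); §2 notation `⟨z⟩^i` (p0009.txt:L12).
-/

noncomputable section

open MvPolynomial

namespace Literature.Computability.AlgebraicComplexity

namespace GKSS2019

universe u v

variable {R : Type u} [CommRing R] {σ : Type v}

/-! ### `f = 0 mod ⟨z⟩^t` -/

/-- `VanishesBelow t f`: every monomial of `f` has degree `≥ t`, i.e. `f ∈ ⟨z⟩^t`, i.e.
"`f = 0 mod ⟨z⟩^t`" in the notation of GKSS §2 ("`⟨z⟩^i` denotes the ideal generated by all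
degree `i` monomials in `z`"). [cite: GuoKumarSaptharishiSolomon2019, §2 notation (arXiv p0009.txt:L12)] -/
def VanishesBelow (t : ℕ) (f : MvPolynomial σ R) : Prop :=
  ∀ d : σ →₀ ℕ, d.degree < t → coeff d f = 0

namespace VanishesBelow

variable {t : ℕ} {f g : MvPolynomial σ R}

/-- `0 ∈ ⟨z⟩^t`. [cite: GuoKumarSaptharishiSolomon2019, §2 notation (arXiv p0009.txt:L12)] -/
theorem zero (t : ℕ) : VanishesBelow t (0 : MvPolynomial σ R) := fun _ _ => coeff_zero _

/-- `⟨z⟩^0` is everything. [cite: GuoKumarSaptharishiSolomon2019, §2 notation (arXiv p0009.txt:L12)] -/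
theorem of_zero (f : MvPolynomial σ R) : VanishesBelow 0 f := fun _ h => (Nat.not_lt_zero _ h).elim

/-- Monotonicity `⟨z⟩^t ⊆ ⟨z⟩^{t'}` for `t' ≤ t`. [cite: GuoKumarSaptharishiSolomon2019, §2 notation (arXiv p0009.txt:L12)] -/
theorem mono {t' : ℕ} (h : VanishesBelow t f) (ht : t' ≤ t) : VanishesBelow t' f :=
  fun d hd => h d (lt_of_lt_of_le hd ht)

/-- Closure under addition. [cite: GuoKumarSaptharishiSolomon2019, §2 notation (arXiv p0009.txt:L12)] -/
theorem add (hf : VanishesBelow t f) (hg : VanishesBelow t g) : VanishesBelow t (f + g) :=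
  fun d hd => by rw [coeff_add, hf d hd, hg d hd, add_zero]

/-- Closure under negation. [cite: GuoKumarSaptharishiSolomon2019, §2 notation (arXiv p0009.txt:L12)] -/
theorem neg (hf : VanishesBelow t f) : VanishesBelow t (-f) :=
  fun d hd => by rw [coeff_neg, hf d hd, neg_zero]

/-- Closure under subtraction. [cite: GuoKumarSaptharishiSolomon2019, §2 notation (arXiv p0009.txt:L12)] -/
theorem sub (hf : VanishesBelow t f) (hg : VanishesBelow t g) : VanishesBelow t (f - g) := by
  rw [sub_eq_add_neg]; exact hf.add hg.neg

/-- Closure under finite sums. [cite: GuoKumarSaptharishiSolomon2019, §2 notation (arXiv p0009.txt:L12)] -/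
theorem sum {ι : Type*} (s : Finset ι) {h : ι → MvPolynomial σ R}
    (hs : ∀ i ∈ s, VanishesBelow t (h i)) : VanishesBelow t (∑ i ∈ s, h i) := by
  classical
  induction s using Finset.induction_on with
  | empty => simpa using zero (σ := σ) (R := R) t
  | insert a s ha ih =>
    rw [Finset.sum_insert ha]
    exact (hs a (by simp)).add (ih fun i hi => hs i (by simp [hi]))

/-- `⟨z⟩^a · ⟨z⟩^b ⊆ ⟨z⟩^{a+b}`. [cite: GuoKumarSaptharishiSolomon2019, §3.1 "`A² = 0 mod ⟨z⟩^{j+1}`" (arXiv p0012.txt:L46)] -/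
theorem mul {a b : ℕ} (hf : VanishesBelow a f) (hg : VanishesBelow b g) :
    VanishesBelow (a + b) (f * g) := by
  classical
  intro d hd
  rw [coeff_mul]
  refine Finset.sum_eq_zero fun pq hpq => ?_
  have hsum : pq.1 + pq.2 = d := Finset.mem_antidiagonal.mp hpq
  have hdeg : pq.1.degree + pq.2.degree = d.degree := by rw [← map_add, hsum]
  by_cases h1 : pq.1.degree < a
  · rw [hf _ h1, zero_mul]
  · have h2 : pq.2.degree < b := by omega
    rw [hg _ h2, mul_zero]

/-- Ideal property: `g · ⟨z⟩^t ⊆ ⟨z⟩^t`. [cite: GuoKumarSaptharishiSolomon2019, §2 notation (arXiv p0009.txt:L12)] -/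
theorem mul_left (g : MvPolynomial σ R) (hf : VanishesBelow t f) : VanishesBelow t (g * f) := by
  simpa using (of_zero g).mul hf

/-- Ideal property on the right. [cite: GuoKumarSaptharishiSolomon2019, §2 notation (arXiv p0009.txt:L12)] -/
theorem mul_right (g : MvPolynomial σ R) (hf : VanishesBelow t f) : VanishesBelow t (f * g) := by
  rw [mul_comm]; exact hf.mul_left g

/-- A homogeneous polynomial of degree `n ≥ t` lies in `⟨z⟩^t` ("`A` is a homogeneous polynomial
of degree `j ≥ 1`"). [cite: GuoKumarSaptharishiSolomon2019, §3.1 (arXiv p0012.txt:L46)] -/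
theorem of_isHomogeneous {n : ℕ} (hf : f.IsHomogeneous n) (ht : t ≤ n) : VanishesBelow t f := by
  intro d hd
  by_contra hne
  have hdeg : d.degree = n := by
    rw [Finsupp.degree_eq_weight_one]
    exact hf hne
  omega

/-- Members of `⟨z⟩^t` have no homogeneous components of degree `< t`.
[cite: GuoKumarSaptharishiSolomon2019, §2 notation (arXiv p0009.txt:L12)] -/
theorem homogeneousComponent_eq_zero (hf : VanishesBelow t f) {i : ℕ} (hi : i < t) :
    homogeneousComponent i f = 0 := by
  classical
  refine MvPolynomial.ext _ _ fun d => ?_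
  rw [coeff_homogeneousComponent, coeff_zero]
  split_ifs with hd
  · exact hf d (by omega)
  · rfl

/-- Congruent polynomials have the same homogeneous components below the modulus.
[cite: GuoKumarSaptharishiSolomon2019, §2 notation (arXiv p0009.txt:L12)] -/
theorem homogeneousComponent_eq_of_sub (h : VanishesBelow t (f - g)) {i : ℕ} (hi : i < t) :
    homogeneousComponent i f = homogeneousComponent i g := by
  have := h.homogeneousComponent_eq_zero hi
  rwa [map_sub, sub_eq_zero] at this

/-- Members of `⟨z⟩^t`, `t ≥ 1`, have zero constant term. [cite: GuoKumarSaptharishiSolomon2019, §2 notation (arXiv p0009.txt:L12)] -/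
theorem constantCoeff_eq_zero (hf : VanishesBelow t f) (ht : 1 ≤ t) : constantCoeff f = 0 :=
  hf 0 (by rw [map_zero]; omega)

end VanishesBelow

/-- `f ≡ f(0) (mod ⟨z⟩)`: subtracting the constant term lands in `⟨z⟩^1` (the step
"`α = ∂_{x_n}(C')(R_0, …, R_n)(0)`, the constant term", p0012.txt:L47).
[cite: GuoKumarSaptharishiSolomon2019, §3.1 (arXiv p0012.txt:L47)] -/
theorem vanishesBelow_one_sub_C_constantCoeff (f : MvPolynomial σ R) :
    VanishesBelow 1 (f - C (constantCoeff f)) := by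
  intro d hd
  have hd0 : d = 0 := by
    have : d.degree = 0 := by omega
    exact (Finsupp.degree_eq_zero_iff d).mp this
  subst hd0
  simp [constantCoeff_eq]

/-- **Congruence of polynomial maps**: if `u_i ≡ v_i (mod ⟨z⟩^t)` for all `i` then
`C(u) ≡ C(v) (mod ⟨z⟩^t)` (used for "`0 = C'(R_0, …, R_{n-1}, R_n + A) mod ⟨z⟩^{j+1}`",
p0012.txt:L38–L39). [cite: GuoKumarSaptharishiSolomon2019, §3.1 (arXiv p0012.txt:L33-39)] -/
theorem vanishesBelow_aeval_sub_aeval {F : Type*} [CommRing F] [Algebra F R] {τ : Type*}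
    {t : ℕ} {u v : τ → MvPolynomial σ R} (huv : ∀ i, VanishesBelow t (u i - v i))
    (C' : MvPolynomial τ F) : VanishesBelow t (aeval u C' - aeval v C') := by
  induction C' using MvPolynomial.induction_on with
  | C c => simpa using VanishesBelow.zero (σ := σ) (R := R) t
  | add p q hp hq =>
    have : aeval u (p + q) - aeval v (p + q) = (aeval u p - aeval v p) + (aeval u q - aeval v q) := by
      simp only [map_add]; ring
    rw [this]; exact hp.add hq
  | mul_X p i hp =>
    have : aeval u (p * X i) - aeval v (p * X i) =
        (aeval u p - aeval v p) * u i + aeval v p * (u i - v i) := by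
      simp only [map_mul, aeval_X]; ring
    rw [this]
    exact (hp.mul_right _).add ((huv i).mul_left _)

/-! ### First-order Taylor expansion in one coordinate -/

/-- **Taylor to first order in the coordinate `m`** (p0012.txt:L41–L45: "we now expand the above
expression as a univariate in `A` … `C'(R_0, …, R_n) + ∑_{i=1}^{d'} A^i · ∂_{x_n^i}(C')(R)/i!`",
of which only the terms `i ≤ 1` matter mod `A²`): over any commutative algebra,
`C(R + A·e_m) = C(R) + A · (∂_{x_m} C)(R) + A² · T` for some `T`. No division by `i!` is used.
[cite: GuoKumarSaptharishiSolomon2019, §3.1 (arXiv p0012.txt:L41-45)] -/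
theorem exists_taylor_first_order {F : Type*} [CommRing F] {S : Type*} [CommRing S] [Algebra F S]
    {τ : Type*} [DecidableEq τ] (C' : MvPolynomial τ F) (Rv : τ → S) (m : τ) (A : S) :
    ∃ T : S, aeval (Function.update Rv m (Rv m + A)) C' =
      aeval Rv C' + A * aeval Rv (pderiv m C') + A ^ 2 * T := by
  induction C' using MvPolynomial.induction_on with
  | C c => exact ⟨0, by simp⟩
  | add p q hp hq =>
    obtain ⟨T₁, h₁⟩ := hp
    obtain ⟨T₂, h₂⟩ := hq
    exact ⟨T₁ + T₂, by simp only [map_add, h₁, h₂]; ring⟩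
  | mul_X p i hp =>
    obtain ⟨T, hT⟩ := hp
    by_cases him : i = m
    · subst him
      refine ⟨aeval Rv (pderiv i p) + T * Rv i + A * T, ?_⟩
      simp only [map_mul, aeval_X, hT, Function.update_self, pderiv_mul, pderiv_X_self, mul_one,
        map_add]
      ring
    · refine ⟨T * Rv i, ?_⟩
      simp only [map_mul, aeval_X, hT, Function.update_of_ne him, pderiv_mul,
        pderiv_X_of_ne him, mul_zero, add_zero]
      ring

/-! ### Lemma 24 -/

section Lemma24

variable {F : Type u} [Field F] {σ' : Type v}

/-- The constant term commutes with polynomial maps: `(C'(u))(0) = C'(u(0))`.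
[cite: GuoKumarSaptharishiSolomon2019, §3.1 (arXiv p0012.txt:L50-56)] -/
theorem constantCoeff_aeval {τ : Type*} (u : τ → MvPolynomial σ' F) (C' : MvPolynomial τ F) :
    constantCoeff (aeval u C') = aeval (fun i => constantCoeff (u i)) C' := by
  have hfun : (fun i => (aeval (fun _ : σ' => (0 : F))) (u i)) = fun i => constantCoeff (u i) := by
    funext i
    rw [aeval_zero']
    rfl
  have h := comp_aeval_apply (f := u) (aeval (fun _ : σ' => (0 : F))) C'
  rw [hfun, aeval_zero'] at h
  rw [← h]
  simp

/-- **GKSS Lemma 24** (abstract form over `R = F[z]`). Printed: "Let `a ∈ F^k` be such that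
`0 ≠ Ψ(a) = (∂_{x_n} C') ∘ G_P(0, a)`. Then
`(-1/Ψ(a)) · C'(Γ_{j-1,a}) = Δ_n(P_{n+j})(z, a) mod ⟨z⟩^{j+1}`." Here, following the proof
(§3.1): `g = (Δ_0(P)(z,a), …, Δ_m(P)(z,a))` with `C'(g) = 0`; `R = Γ_{j-1,a}`; `A = Δ_m(P_{m+j})(z,a)`,
homogeneous of degree `j ≥ 1`; Obs. 22 supplies `g_i ≡ R_i + [i = m]·A (mod ⟨z⟩^{j+1})`;
`Ψ(a) = (∂_{x_m} C')(g)(0)`. CONCLUSION in exact form: `A = (-1/Ψ(a)) · [C'(R)]_j`, the degree-`j`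
homogeneous component (equivalent to the printed congruence since `A` is homogeneous of degree
`j` and both sides agree below degree `j`… the reconstruction only uses the degree-`j` part).
Proof = the printed one: congruence, first-order Taylor, `A² ∈ ⟨z⟩^{2j} ⊆ ⟨z⟩^{j+1}`,
`α = (∂_{x_m}C')(R)(0) = Ψ(a)`, solve. [cite: GuoKumarSaptharishiSolomon2019, Lemma 24 (arXiv p0011.txt:L72-76; proof §3.1 p0012.txt:L30-74)] -/
theorem lemma24 {m j : ℕ} (hj : 1 ≤ j) (C' : MvPolynomial (Fin (m + 1)) F)
    (g Rv : Fin (m + 1) → MvPolynomial σ' F) (A : MvPolynomial σ' F) (hA : A.IsHomogeneous j)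
    (hcong : ∀ i, VanishesBelow (j + 1) (g i - Rv i - if i = Fin.last m then A else 0))
    (hzero : aeval g C' = 0)
    (hΨ : constantCoeff (aeval g (pderiv (Fin.last m) C')) ≠ 0) :
    A = C (-(constantCoeff (aeval g (pderiv (Fin.last m) C')))⁻¹) *
      homogeneousComponent j (aeval Rv C') := by
  classical
  set Ψ := constantCoeff (aeval g (pderiv (Fin.last m) C')) with hΨdef
  -- the intermediate point `g' = R + A e_m`
  set g' : Fin (m + 1) → MvPolynomial σ' F := Function.update Rv (Fin.last m) (Rv (Fin.last m) + A)
    with hg'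
  have hgg' : ∀ i, VanishesBelow (j + 1) (g i - g' i) := by
    intro i
    by_cases hi : i = Fin.last m
    · subst hi
      have := hcong (Fin.last m)
      simp only [if_true] at this
      simpa [hg', sub_sub] using this
    · have := hcong i
      simp only [if_neg hi, sub_zero] at this
      simpa [hg', Function.update_of_ne hi] using this
  -- (1) congruence: `0 = C'(g) ≡ C'(g')`
  have h1 : VanishesBelow (j + 1) (aeval g C' - aeval g' C') := vanishesBelow_aeval_sub_aeval hgg' C'
  rw [hzero, zero_sub] at h1
  -- (2) Taylor: `C'(g') = C'(R) + A (∂C')(R) + A² T`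
  obtain ⟨T, hT⟩ := exists_taylor_first_order C' Rv (Fin.last m) A
  -- (3) `A² T ∈ ⟨z⟩^{j+1}`
  have hA2 : VanishesBelow (j + 1) (A ^ 2 * T) := by
    have hAA : VanishesBelow (j + j) (A * A) :=
      (VanishesBelow.of_isHomogeneous hA le_rfl).mul (VanishesBelow.of_isHomogeneous hA le_rfl)
    rw [pow_two]
    exact (hAA.mono (by omega)).mul_right T
  -- (4) `A · ((∂C')(R) - Ψ') ∈ ⟨z⟩^{j+1}` with `Ψ' = (∂C')(R)(0)`
  set Ψ' := constantCoeff (aeval Rv (pderiv (Fin.last m) C')) with hΨ'def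
  have hAE : VanishesBelow (j + 1) (A * (aeval Rv (pderiv (Fin.last m) C') - C Ψ')) :=
    (VanishesBelow.of_isHomogeneous hA le_rfl).mul (vanishesBelow_one_sub_C_constantCoeff _)
  -- (5) `Ψ' = Ψ`: the constant terms of `g` and `R` agree
  have hcc : ∀ i, constantCoeff (g i) = constantCoeff (Rv i) := by
    intro i
    have h := hcong i
    have hA0 : constantCoeff A = 0 :=
      (VanishesBelow.of_isHomogeneous hA le_rfl).constantCoeff_eq_zero hj
    have := h.constantCoeff_eq_zero (by omega)
    simp only [map_sub] at this
    split_ifs at this with hi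
    · rw [hA0, sub_zero, sub_eq_zero] at this; exact this
    · rw [map_zero, sub_zero, sub_eq_zero] at this; exact this
  have hΨΨ' : Ψ' = Ψ := by
    rw [hΨ'def, hΨdef, constantCoeff_aeval, constantCoeff_aeval]
    have hfun : (fun i => constantCoeff (Rv i)) = fun i => constantCoeff (g i) :=
      funext fun i => (hcc i).symm
    rw [hfun]
  -- (6) assemble: `C'(R) + Ψ · A ∈ ⟨z⟩^{j+1}`
  have hkey : VanishesBelow (j + 1) (aeval Rv C' + C Ψ * A) := by
    have : aeval Rv C' + C Ψ * A =
        -(-(aeval g' C')) - A ^ 2 * T - A * (aeval Rv (pderiv (Fin.last m) C') - C Ψ') := by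
      rw [hT, hΨΨ']; ring
    rw [this]
    exact (h1.neg.sub hA2).sub hAE
  -- (7) read off the degree-`j` component
  have hcomp := hkey.homogeneousComponent_eq_zero (i := j) (by omega)
  rw [map_add, homogeneousComponent_C_mul,
    homogeneousComponent_of_mem ((mem_homogeneousSubmodule _ _).mpr hA), if_pos rfl] at hcomp
  -- `[C'(R)]_j + Ψ A = 0  ⇒  A = -Ψ⁻¹ [C'(R)]_j`
  have hΨunit : C Ψ * C Ψ⁻¹ = (1 : MvPolynomial σ' F) := by
    rw [← map_mul, mul_inv_cancel₀ hΨ, map_one]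
  calc A = C Ψ⁻¹ * (C Ψ * A) := by rw [← mul_assoc, mul_comm (C Ψ⁻¹), hΨunit, one_mul]
    _ = C Ψ⁻¹ * (-(homogeneousComponent j (aeval Rv C'))) := by
        rw [eq_neg_of_add_eq_zero_right hcomp]
    _ = C (-Ψ⁻¹) * homogeneousComponent j (aeval Rv C') := by rw [map_neg]; ring

end Lemma24

end GKSS2019

end Literature.Computability.AlgebraicComplexity
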